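import Mathlib
import Summits.ValiantsHypothesis.ValiantsHypothesis.Theorems.LacunarySymmetroidMatrixDescartesDoorA26WallBubblingBubblingDefs

/-!
# Normalisation glue (B5) — turnkey helper, val-idea-15

Module of the BUBBLING REDUCTION for obligation (B) `Stmt.stub_bubbling` of the line `Cruxes/DoorA26/Lines/wall_bubbling.lean`
(stmt-ValiantsHypothesis-19979, `Theses.LacunarySymmetroid.DoorA26`).  Contents: `det_rpow_pencil` (the pencil determinant as a double sum of polar Gram coefficients), `det_rpow_pencil_eq_valueSum`,
`ncard_zeros_pos_eq` (`x = exp t`), `realisable_polarGram`, `realisable_smul`, `blockSumsZero_smul`, `blockSum_tendsto`. [this work]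

HONEST FRAMING / PROVENANCE.  Turnkey port of ideator val-idea-15 g1 (crux workfile `Cruxes/DoorA26/Lines/wall_bubbling_Assembly.lean`, commit d4cb61350496, ZERO `sorry`; split into ≤ 400-line modules, one
namespace `…WallBubbling.Bubbling`, single copies of the definitions), filed by prover seat val-port-4 g1 (val-lit port pool; desk g12 RULING #266 (b), director R166/R168) with `--supports stmt-ValiantsHypothesis-19979 --as helper`.
Mathlib-only mathematics (elementary real analysis, linear algebra, finite combinatorics); nothing here bears on `DoorA26` (OPEN; obligations (W), (M), (R) of the line remain),
on `MatrixDescartes` (stmt-ValiantsHypothesis-18050) or on `VP ≠ VNP`.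
-/

-- `Summit.ValiantsHypothesis.ValiantsHypothesis.…` repeats a component by the D-0017 layout
-- (single-conjunct summit), which the `dupNamespace` linter flags; the name is mandated.
set_option linter.dupNamespace false

namespace Summit.ValiantsHypothesis.ValiantsHypothesis.Theorems.LacunarySymmetroidMatrixDescartes.WallBubbling.Bubbling

/-! # Part IV — normalisation glue (B5; workfile `Lines/wall_bubbling_Normalisation.lean`) -/


open Matrix Finset




/-! ## B5a — the determinant of a `2 × 2` pencil is the polar double sum -/

/-- Entrywise formula for `polar` (no symmetry needed). [this work] -/
theorem polar_apply (S T : Matrix (Fin 2) (Fin 2) ℝ) :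
    polar S T = (S 0 0 * T 1 1 + T 0 0 * S 1 1 - S 0 1 * T 1 0 - T 0 1 * S 1 0) / 2 := by
  simp only [polar, Matrix.det_fin_two, Matrix.add_apply]
  ring

/-- `polar` is symmetric. [this work] -/
theorem polar_comm (S T : Matrix (Fin 2) (Fin 2) ℝ) : polar S T = polar T S := by
  rw [polar_apply, polar_apply]; ring

/-- `polar S S = det S`. [this work] -/
theorem polar_self (S : Matrix (Fin 2) (Fin 2) ℝ) : polar S S = S.det := by
  rw [polar_apply, Matrix.det_fin_two]; ring

/-- **B5a.**  `det (∑ₗ cₗ • Sₗ) = ∑ₖ ∑ₗ cₖ cₗ · polar Sₖ Sₗ` for any family of `2 × 2` real matrices. [folklore] -/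
theorem det_sum_smul_fin_two {K : ℕ} (c : Fin K → ℝ) (S : Fin K → Matrix (Fin 2) (Fin 2) ℝ) :
    (∑ l, c l • S l).det = ∑ k, ∑ l, c k * c l * polar (S k) (S l) := by
  -- right-hand side: split the symmetric summand into two mirror halves
  have hsplit : (∑ k, ∑ l, c k * c l * polar (S k) (S l))
      = (∑ k, ∑ l, c k * c l * (S k 0 0 * S l 1 1 - S k 0 1 * S l 1 0) / 2)
        + ∑ k, ∑ l, c k * c l * (S l 0 0 * S k 1 1 - S l 0 1 * S k 1 0) / 2 := by
    rw [← Finset.sum_add_distrib]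
    refine Finset.sum_congr rfl fun k _ => ?_
    rw [← Finset.sum_add_distrib]
    refine Finset.sum_congr rfl fun l _ => ?_
    rw [polar_apply]
    ring
  have hmirror : (∑ k, ∑ l, c k * c l * (S l 0 0 * S k 1 1 - S l 0 1 * S k 1 0) / 2)
      = ∑ k, ∑ l, c k * c l * (S k 0 0 * S l 1 1 - S k 0 1 * S l 1 0) / 2 := by
    rw [Finset.sum_comm]
    refine Finset.sum_congr rfl fun k _ => Finset.sum_congr rfl fun l _ => ?_
    ring
  rw [hsplit, hmirror, ← two_mul, Finset.mul_sum]
  simp_rw [Finset.mul_sum]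
  -- left-hand side
  rw [Matrix.det_fin_two]
  simp only [Matrix.sum_apply, Matrix.smul_apply, smul_eq_mul]
  rw [Finset.sum_mul_sum, Finset.sum_mul_sum, ← Finset.sum_sub_distrib]
  refine Finset.sum_congr rfl fun k _ => ?_
  rw [← Finset.sum_sub_distrib]
  refine Finset.sum_congr rfl fun l _ => ?_
  ring

/-! ## B5b — real-exponent pencils -/

/-- **B5b.**  For `0 < x`: `det (∑ₗ x^{δₗ} • Sₗ) = ∑ₖ ∑ₗ polar Sₖ Sₗ · x^{δₖ + δₗ}`. [folklore] -/
theorem det_rpow_pencil {K : ℕ} (δ : Fin K → ℝ) (S : Fin K → Matrix (Fin 2) (Fin 2) ℝ) {x : ℝ} (hx : 0 < x) :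
    (∑ l, (x ^ (δ l)) • S l).det = ∑ k, ∑ l, polar (S k) (S l) * x ^ (δ k + δ l) := by
  rw [det_sum_smul_fin_two]
  refine Finset.sum_congr rfl fun k _ => Finset.sum_congr rfl fun l _ => ?_
  rw [Real.rpow_add hx]
  ring

/-! ## B5c — regrouping by pair-sum values -/

/-- **B5c.**  Regrouping a pair sum by the VALUES of `δₖ + δₗ`: the coefficient of `φ v` is the block sum of the value
class `v` (the quantity in `BlockSumsZero`). [folklore] -/
theorem sum_pairs_eq_sum_values {K : ℕ} (δ : Fin K → ℝ) (G : Matrix (Fin K) (Fin K) ℝ) (φ : ℝ → ℝ) :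
    (∑ k, ∑ l, G k l * φ (δ k + δ l))
      = ∑ v ∈ Finset.univ.image (fun p : Fin K × Fin K => δ p.1 + δ p.2),
          (∑ k, ∑ l, if δ k + δ l = v then G k l else 0) * φ v := by
  classical
  set V := Finset.univ.image (fun p : Fin K × Fin K => δ p.1 + δ p.2) with hV
  -- pass to the product index
  have hL : (∑ k, ∑ l, G k l * φ (δ k + δ l)) = ∑ p : Fin K × Fin K, G p.1 p.2 * φ (δ p.1 + δ p.2) := by
    rw [← Finset.sum_product']
    rfl
  have hR : ∀ v, (∑ k, ∑ l, if δ k + δ l = v then G k l else 0)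
      = ∑ p : Fin K × Fin K, if δ p.1 + δ p.2 = v then G p.1 p.2 else 0 := by
    intro v
    rw [← Finset.sum_product']
    rfl
  rw [hL]
  simp_rw [hR]
  -- fiberwise regrouping over the image
  rw [← Finset.sum_fiberwise_of_maps_to (s := (Finset.univ : Finset (Fin K × Fin K))) (t := V)
    (g := fun p : Fin K × Fin K => δ p.1 + δ p.2)
    (fun p hp => Finset.mem_image_of_mem _ hp)]
  refine Finset.sum_congr rfl fun v _ => ?_
  rw [Finset.sum_mul, Finset.sum_filter]
  refine Finset.sum_congr rfl fun p _ => ?_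
  split_ifs with h
  · rw [h]
  · rw [zero_mul]

/-- **B5a–c combined.**  The pencil determinant as a real-exponent polynomial over the pair-sum values, with the block sums
of the polar Gram matrix `G_S = (polar Sₖ Sₗ)` as coefficients. [folklore] -/
theorem det_rpow_pencil_eq_valueSum {K : ℕ} (δ : Fin K → ℝ) (S : Fin K → Matrix (Fin 2) (Fin 2) ℝ) {x : ℝ}
    (hx : 0 < x) :
    (∑ l, (x ^ (δ l)) • S l).det
      = ∑ v ∈ Finset.univ.image (fun p : Fin K × Fin K => δ p.1 + δ p.2),
          (∑ k, ∑ l, if δ k + δ l = v then polar (S k) (S l) else 0) * x ^ v := by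
  rw [det_rpow_pencil δ S hx]
  exact sum_pairs_eq_sum_values δ (Matrix.of fun k l => polar (S k) (S l)) (fun v => x ^ v)

/-- If all block sums vanish, the pencil determinant vanishes identically on `(0, ∞)` (so such `G_S` never come from a
point of the twenty-locus — used contrapositively in B12: the normalised limit pattern is a blow-up pattern). [this work] -/
theorem det_rpow_pencil_eq_zero_of_blockSums {K : ℕ} (δ : Fin K → ℝ) (S : Fin K → Matrix (Fin 2) (Fin 2) ℝ)
    (h : ∀ v : ℝ, (∑ k, ∑ l, if δ k + δ l = v then polar (S k) (S l) else 0) = 0) {x : ℝ} (hx : 0 < x) :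
    (∑ l, (x ^ (δ l)) • S l).det = 0 := by
  rw [det_rpow_pencil_eq_valueSum δ S hx]
  exact Finset.sum_eq_zero fun v _ => by rw [h v, zero_mul]

/-! ## B5d — positive zeros versus real zeros under `x = exp t` -/

/-- The positive zero set of `F` is the `exp`-image of the real zero set of `F ∘ exp`. [this work] -/
theorem zeros_pos_eq_image_exp (F : ℝ → ℝ) :
    {x : ℝ | 0 < x ∧ F x = 0} = Real.exp '' {t : ℝ | F (Real.exp t) = 0} := by
  ext x
  constructor
  · rintro ⟨hx, hF⟩
    exact ⟨Real.log x, by rw [Set.mem_setOf_eq, Real.exp_log hx]; exact hF, Real.exp_log hx⟩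
  · rintro ⟨t, ht, rfl⟩
    exact ⟨Real.exp_pos t, ht⟩

/-- **B5d.**  Counting positive zeros of `F` = counting real zeros of `F ∘ exp`. [folklore] -/
theorem ncard_zeros_pos_eq (F : ℝ → ℝ) :
    {x : ℝ | 0 < x ∧ F x = 0}.ncard = {t : ℝ | F (Real.exp t) = 0}.ncard := by
  rw [zeros_pos_eq_image_exp, Set.ncard_image_of_injective _ Real.exp_injective]

/-- `x ^ v` along `x = exp t` is `exp (v t)`. [this work] -/
theorem rpow_exp_eq (v t : ℝ) : (Real.exp t) ^ v = Real.exp (v * t) := by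
  rw [← Real.exp_mul, mul_comm]

/-! ## B5e–f — the polar Gram matrix is realisable; scaling -/

/-- **B5e.**  The polar Gram matrix of six symmetric letters is realisable (`ε = 1`). [this work] -/
theorem realisable_polarGram (S : Fin 6 → Matrix (Fin 2) (Fin 2) ℝ) (hS : ∀ l, (S l).IsSymm) :
    Realisable (Matrix.of fun k l => polar (S k) (S l)) :=
  ⟨1, S, Or.inl rfl, hS, fun i j => by rw [Matrix.of_apply, one_mul]⟩

/-- `polar` is homogeneous: `polar (a • S) (a • T) = a² · polar S T`. [this work] -/
theorem polar_smul_smul (a : ℝ) (S T : Matrix (Fin 2) (Fin 2) ℝ) :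
    polar (a • S) (a • T) = a * a * polar S T := by
  rw [polar_apply, polar_apply]
  simp only [Matrix.smul_apply, smul_eq_mul]
  ring

/-- **B5f.**  The realisable cone is invariant under ALL real scalings (`c ≥ 0`: rescale the letters by `√c`;
`c < 0`: also flip `ε`).  In particular the normalisation `G / ‖G‖` of B12 stays realisable. [folklore] -/
theorem realisable_smul (c : ℝ) {G : Matrix (Fin 6) (Fin 6) ℝ} (hG : Realisable G) : Realisable (c • G) := by
  obtain ⟨ε, S, hε, hS, hG⟩ := hG
  have hsymm : ∀ (a : ℝ) l, (a • S l).IsSymm := fun a l => (hS l).smul a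
  rcases le_or_gt 0 c with hc | hc
  · refine ⟨ε, fun l => Real.sqrt c • S l, hε, hsymm _, fun i j => ?_⟩
    rw [Matrix.smul_apply, smul_eq_mul, hG i j, polar_smul_smul, Real.mul_self_sqrt hc]
    ring
  · refine ⟨-ε, fun l => Real.sqrt (-c) • S l, ?_, hsymm _, fun i j => ?_⟩
    · rcases hε with rfl | rfl
      · right; rfl
      · left; norm_num
    · rw [Matrix.smul_apply, smul_eq_mul, hG i j, polar_smul_smul, Real.mul_self_sqrt (by linarith)]
      ring

/-- Block sums are linear: scaling preserves `BlockSumsZero`. [this work] -/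
theorem blockSumsZero_smul (δ : Fin 6 → ℝ) (c : ℝ) {G : Matrix (Fin 6) (Fin 6) ℝ} (hG : BlockSumsZero δ G) :
    BlockSumsZero δ (c • G) := by
  intro v
  have h := hG v
  have : (∑ k, ∑ l, if δ k + δ l = v then (c • G) k l else 0)
      = c * ∑ k, ∑ l, if δ k + δ l = v then G k l else 0 := by
    rw [Finset.mul_sum]
    refine Finset.sum_congr rfl fun k _ => ?_
    rw [Finset.mul_sum]
    refine Finset.sum_congr rfl fun l _ => ?_
    split_ifs <;> simp [Matrix.smul_apply]
  rw [this, h, mul_zero]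

/-- Block sums pass to entrywise limits (the `BlockSumsZero` half of the bubbling limit in B12 is a limit of linear
identities). [this work] -/
theorem blockSum_tendsto (δ : Fin 6 → ℝ) (v : ℝ) {Gseq : ℕ → Matrix (Fin 6) (Fin 6) ℝ} {G : Matrix (Fin 6) (Fin 6) ℝ}
    (hlim : Filter.Tendsto Gseq Filter.atTop (nhds G)) :
    Filter.Tendsto (fun ν => ∑ k, ∑ l, if δ k + δ l = v then Gseq ν k l else 0) Filter.atTop
      (nhds (∑ k, ∑ l, if δ k + δ l = v then G k l else 0)) := by
  refine tendsto_finsetSum _ fun k _ => tendsto_finsetSum _ fun l _ => ?_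
  split_ifs
  · exact ((continuous_apply l).comp (continuous_apply k)).continuousAt.tendsto.comp hlim
  · exact tendsto_const_nhds

end Summit.ValiantsHypothesis.ValiantsHypothesis.Theorems.LacunarySymmetroidMatrixDescartes.WallBubbling.Bubbling
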